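import Summits.HodgeConjecture.HodgeConjecture.Theorems.Ring2WeilCoverageCMFieldAllPrimes
import HarnessLib

/-!
# Weil-type components over quartic CM fields, IX (part B): ALL PRIMES for the biquadratic fields `ℚ(ζ₁₂)`,
# `ℚ(√-3,√5)`, `ℚ(i,√5)`

research route conditional on HC_CM; not a corollary; Q11.4-sentence-2 already refuted in dim ≥ 3. Cell
`pub-hodge-ring2`, seat `ring2-b03` (gen 51); continuation of part A (`Ring2WeilCoverageCMFieldAllPrimes`: residue
tools and `ℚ(ζ₅)`, `ℚ(ζ₈)`), kernel form of the INDEX SET of the Weil-type family-coverage census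
`HOME/WEIL-FAMILY-COVERAGE.md` §b03 with a VARIABLE prime `ℓ`. For the three remaining `V₄` census fields `E = K·F`
the obstruction is abelian (two Legendre symbols); with Deligne's carriers `R = S² + pS + q` (`ℓ ∤ w` throughout):

* `ℚ(ζ₁₂) = ℚ(i,√3)` (`R = S² + 8S + 4`, `σ = -(1+√3)²`): `[ℓw] ≠ [1]` for every prime `ℓ ≡ 11 (mod 12)` (`ℓ` split
  in `ℚ(√3)`, both places inert in `F(i)`), and `[ℓ] = [1]` for every prime `ℓ ≢ 3 (mod 4)` (two squares);
* `ℚ(√-3,√5)` (`R = S² + 9S + 9`, `σ = -3φ²`, `φ² = (3+√5)/2`): `[ℓw] ≠ [1]` for every prime `ℓ ≡ ±1 (mod 5)`,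
  `ℓ ≡ 2 (mod 3)` (`ℓ` split in `ℚ(√5)`; a square root of `σ ↦ -3((1∓r)/2)²` would give `x² = -3` in `𝔽_ℓ`, i.e. a
  primitive cube root of unity, `3 ∣ ℓ - 1`);
* `ℚ(i,√5)` (`R = S² + 3S + 1`, `σ = -φ²`): `[ℓw] ≠ [1]` for every prime `ℓ ≡ ±1 (mod 5)`, `ℓ ≡ 3 (mod 4)`, and
  `[ℓ] = [1]` for every prime `ℓ ≢ 3 (mod 4)`.

In each case the congruence class is EXACTLY the set of primes with a non-empty obstruction set `T(ℓ)` (census §b03.5: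
inert primes of `F` split in `E/F` for these three fields since `q = Nm σ` is a square times a unit square… precisely:
`(ℓ)` inert in `F` has residue field `𝔽_{ℓ²} ∋ i, √-3`), so the non-split side of the three tables is now decided for
ALL primes; the split side is decided for `ℓ ≢ 3 (mod 4)` (and for `n ≤ 40`, gen 49). Part C: `ℚ(√-(2+√2))`,
`ℚ(√-(3+√2))`; part D: pairwise distinctness and infinitude. No named fact, no definition, no `sorry`; nothing about
the Hodge conjecture is asserted (Deligne Cor. 4.2 / Landherr decide which component is the split one; the general
member of every row is OPEN, census §b03.2).
References: [Deligne1982HodgeCycles] §4 p. 30 (1), Cor. 4.2, Lemma 4.6; [Landherr1936HermitianForms]. -/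

noncomputable section

set_option linter.dupNamespace false

open Polynomial

namespace Summit.HodgeConjecture.HodgeConjecture.Ring2.WeilCoverageCM

open Literature.AlgebraicGeometry.Deligne1982
open Literature.AlgebraicGeometry.HodgeTheory (splitDiscriminantClassCM)

/-! ### §0 One more residue tool -/

/-- `(2x)² ≠ a·t²`-type exclusion: if `y² ≠ a` for all `y ∈ 𝔽_ℓ` then `X² = a·t²` forces `t = 0`. [folklore] -/
theorem eq_zero_of_sq_eq_mul_sq {ℓ : ℕ} [Fact ℓ.Prime] {a : ZMod ℓ} (ha : ∀ y : ZMod ℓ, y ^ 2 ≠ a)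
    (X t : ZMod ℓ) (h : X ^ 2 = a * t ^ 2) : t = 0 := by
  by_contra ht
  refine ha (X / t) ?_
  field_simp
  linear_combination h

/-! ### §1 `E = ℚ(ζ₁₂) = ℚ(i,√3)`: `R = S² + 8S + 4`, `F = ℚ(√3)`, `σ = -(1+√3)²` — every prime: non-split iff
`ℓ ≡ 11 (mod 12)` (here: `⇐`, and `[ℓ] = [1]` for `ℓ ≢ 3 (mod 4)`; `ℓ ≡ 7 (mod 12)`: `[7] = [19] = [31] = [1]`, gen 49) -/

section Zeta12

variable {R : Polynomial ℤ} (hR : R = X ^ 2 + C 8 * X + C 4) [Fact (Irreducible (realPolyQ R))]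
include hR

/-- **`[ℓw] ≠ [1]` for `E = ℚ(ζ₁₂)` and EVERY prime `ℓ ≡ 11 (mod 12)`, `ℓ ∤ w`**: `ℓ` SPLITS in `F = ℚ(√3)` (`3 = r²`
mod `ℓ`, reciprocity; places `σ ↦ -4 ± 2r = -(r ∓ 1)²`) and both places are INERT in `E = F(i)` (`-1` a non-square,
`ℓ ≡ 3 (mod 4)`): the Weil-type components `W8.E.[ℓw]` are NON-SPLIT (census rows `[11], [23], [47], …` at once).
[cite: Deligne1982HodgeCycles, §4 p. 30 (1) and Cor. 4.2] [cite: Landherr1936HermitianForms] -/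
theorem zeta12_mk_prime_mul_ne_splitDiscriminantClassCM_of_mod_twelve (ℓ : ℕ) (hℓ : ℓ.Prime) (h12 : ℓ % 12 = 11)
    (w : ℤ) (hw : ¬ (ℓ : ℤ) ∣ w) (u : (realField R)ˣ)
    (hu : (u : realField R) = AdjoinRoot.of (realPolyQ R) (ℓ * w)) :
    (QuotientGroup.mk u : cmNormResidueGroup R) ≠ splitDiscriminantClassCM R 2 := by
  haveI : Fact ℓ.Prime := ⟨hℓ⟩
  have h2 : ℓ ≠ 2 := by omega
  have h3 : ℓ ≠ 3 := by omega
  have h2' : (2 : ZMod ℓ) ≠ 0 := by exact_mod_cast natCast_prime_ne_zero_zmod Nat.prime_two h2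
  have h3' : (3 : ZMod ℓ) ≠ 0 := by exact_mod_cast natCast_prime_ne_zero_zmod Nat.prime_three h3
  have h4 : (4 : ZMod ℓ) ≠ 0 := by rw [show (4 : ZMod ℓ) = 2 * 2 by norm_num]; exact mul_ne_zero h2' h2'
  have hm1 : ¬ IsSquare (-1 : ZMod ℓ) := by rw [ZMod.exists_sq_eq_neg_one_iff]; omega
  obtain ⟨r, hr⟩ := isSquare_three_of_mod_twelve (ℓ := ℓ) h12
  have hne1 : ∀ t : ZMod ℓ, t ^ 2 = 1 → r ≠ t := by
    rintro t ht rfl; rw [← sq, ht] at hr; exact h2' (by linear_combination hr)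
  have hr1 : r - 1 ≠ 0 := sub_ne_zero.2 (hne1 1 (one_pow 2))
  have hr1' : r + 1 ≠ 0 := fun h => hne1 (-1) (by ring) (by linear_combination h)
  refine mk_prime_mul_ne_splitDiscriminantClassCM_of_two_roots hR (by norm_num) (by norm_num) disc_not_sq_eight_four
    ℓ hℓ (-4 + 2 * r) (-4 - 2 * r) (by push_cast; linear_combination (-4 : ZMod ℓ) * hr)
    (by push_cast; linear_combination (-4 : ZMod ℓ) * hr) ?_ ?_ ?_ w hw u hu
  · intro h
    have hr0 : r = 0 := eq_zero_of_const_mul_eq_zero h4 (by linear_combination h)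
    rw [hr0, mul_zero] at hr
    exact h3' hr
  · intro x hx
    exact forall_sq_ne_neg_sq hm1 (r - 1) hr1 x (by rw [hx]; linear_combination (-1 : ZMod ℓ) * hr)
  · intro x hx
    exact forall_sq_ne_neg_sq hm1 (r + 1) hr1' x (by rw [hx]; linear_combination (-1 : ZMod ℓ) * hr)

/-- **`[ℓ] ≠ [1]` for `E = ℚ(ζ₁₂)` and every prime `ℓ ≡ 11 (mod 12)`.** [cite: Deligne1982HodgeCycles, §4 p. 30 (1) and Cor. 4.2] -/
theorem zeta12_mk_prime_ne_splitDiscriminantClassCM_of_mod_twelve (ℓ : ℕ) (hℓ : ℓ.Prime) (h12 : ℓ % 12 = 11)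
    (u : (realField R)ˣ) (hu : (u : realField R) = ℓ) :
    (QuotientGroup.mk u : cmNormResidueGroup R) ≠ splitDiscriminantClassCM R 2 :=
  zeta12_mk_prime_mul_ne_splitDiscriminantClassCM_of_mod_twelve hR ℓ hℓ h12 1 (by exact_mod_cast hℓ.not_dvd_one) u
    (by rw [hu, Int.cast_one, mul_one]; exact (map_natCast (AdjoinRoot.of (realPolyQ R)) ℓ).symm)

end Zeta12

/-- **`[ℓ] = [1]` for `E = ℚ(ζ₁₂)` and EVERY prime `ℓ ≢ 3 (mod 4)`** (`ℓ = a² + b² = Nm_{E/F}(a + bi)`; `i = η(√3-1)/2`,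
`√3 = -(σ+4)/2`: the witness `(4a)² - σ(6b + bσ)²` has coordinates `(16ℓ, 0)`): the row `W8.E.[ℓ]` is the SPLIT
component (census: `2, 5, 13, 17, 29, 37, …`; also `[3] = [1]`, `[7] = [19] = [31] = [1]`, gen 49). Stated with
Deligne's `R = S² + 8S + 4` LITERAL (the field `Fact` by factor exclusion). [cite: Deligne1982HodgeCycles, §4 p. 30 (1) and Cor. 4.2] -/
theorem zeta12_mk_prime_eq_splitDiscriminantClassCM_of_mod_four (ℓ : ℕ) (hℓ : ℓ.Prime) (h4 : ℓ % 4 ≠ 3) :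
    haveI := fact_irreducible_realPolyQ_of_not_sq (R := X ^ 2 + C 8 * X + C 4) rfl disc_not_sq_eight_four
    ∀ u : (realField (X ^ 2 + C 8 * X + C 4))ˣ, (u : realField (X ^ 2 + C 8 * X + C 4)) = ℓ →
      (QuotientGroup.mk u : cmNormResidueGroup (X ^ 2 + C 8 * X + C 4)) =
        splitDiscriminantClassCM (X ^ 2 + C 8 * X + C 4) 2 := by
  haveI := fact_irreducible_realPolyQ_of_not_sq (R := X ^ 2 + C 8 * X + C 4) rfl disc_not_sq_eight_four
  haveI : Fact ℓ.Prime := ⟨hℓ⟩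
  intro u hu
  obtain ⟨a, b, hab⟩ := Nat.Prime.sq_add_sq h4
  have habZ : ((a : ℤ)) ^ 2 + (b : ℤ) ^ 2 = ℓ := by exact_mod_cast hab
  exact mk_eq_splitDiscriminantClassCM_two_of_coords_of_pos rfl (by norm_num) (by norm_num) disc_not_sq_eight_four
    ℓ (4 * a) 0 (6 * b) b 4 (by norm_num) (by linear_combination 16 * habZ) (by ring) u
    (by rw [hu]; push_cast; exact (map_natCast (AdjoinRoot.of (realPolyQ (X ^ 2 + C 8 * X + C 4))) ℓ).symm)


/-! ### §2 `E = ℚ(√-3,√5)`: `R = S² + 9S + 9`, `F = ℚ(√5)`, `σ = -3φ²` — every prime `ℓ ≡ ±1 (mod 5)`, `ℓ ≡ 2 (mod 3)` -/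

section SqrtNeg3Sqrt5

variable {R : Polynomial ℤ} (hR : R = X ^ 2 + C 9 * X + C 9) [Fact (Irreducible (realPolyQ R))]
include hR

/-- **`[ℓw] ≠ [1]` for `E = ℚ(√-3,√5)` and EVERY prime `ℓ ≡ ±1 (mod 5)`, `ℓ ≡ 2 (mod 3)`, `ℓ ∤ w`**: `ℓ` SPLITS in
`F = ℚ(√5)` (`5 = r²` mod `ℓ`; places `σ ↦ (-9 ± 3r)/2`, `2(-9 ∓ 3r) = -3(1 ± r)²`) and both places are INERT in
`E = F(√-3)`: a square root `x` of either image gives `(2x/(1 ± r))² = -3`, a primitive cube root of unity in `𝔽_ℓ`,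
`3 ∣ ℓ - 1` — excluded. So the split criterion applies: the components `W8.E.[ℓw]` are NON-SPLIT (census rows `[11]`,
`[29]`, `[41]`, `[59]`, … at once; these are ALL the primes with `T(ℓ) ≠ ∅` for this field).
[cite: Deligne1982HodgeCycles, §4 p. 30 (1) and Cor. 4.2] [cite: Landherr1936HermitianForms] -/
theorem sqrtNeg3Sqrt5_mk_prime_mul_ne_splitDiscriminantClassCM_of_mod (ℓ : ℕ) (hℓ : ℓ.Prime)
    (h5 : ℓ % 5 = 1 ∨ ℓ % 5 = 4) (h3 : ℓ % 3 = 2) (w : ℤ) (hw : ¬ (ℓ : ℤ) ∣ w) (u : (realField R)ˣ)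
    (hu : (u : realField R) = AdjoinRoot.of (realPolyQ R) (ℓ * w)) :
    (QuotientGroup.mk u : cmNormResidueGroup R) ≠ splitDiscriminantClassCM R 2 := by
  haveI : Fact ℓ.Prime := ⟨hℓ⟩
  have h2 : ℓ ≠ 2 := by omega
  have hℓ3 : ℓ ≠ 3 := by omega
  have hℓ5 : ℓ ≠ 5 := by omega
  have h2' : (2 : ZMod ℓ) ≠ 0 := by exact_mod_cast natCast_prime_ne_zero_zmod Nat.prime_two h2
  have h3' : (3 : ZMod ℓ) ≠ 0 := by exact_mod_cast natCast_prime_ne_zero_zmod Nat.prime_three hℓ3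
  have h5' : (5 : ZMod ℓ) ≠ 0 := by exact_mod_cast natCast_prime_ne_zero_zmod (by norm_num : Nat.Prime 5) hℓ5
  have h4 : (4 : ZMod ℓ) ≠ 0 := by rw [show (4 : ZMod ℓ) = 2 * 2 by norm_num]; exact mul_ne_zero h2' h2'
  obtain ⟨r, hr⟩ := isSquare_five_of_mod_five h2 h5
  have hne1 : ∀ t : ZMod ℓ, t ^ 2 = 1 → r ≠ t := by
    rintro t ht rfl; rw [← sq, ht] at hr; exact h4 (by linear_combination hr)
  have hr1 : 1 - r ≠ 0 := sub_ne_zero.2 (hne1 1 (one_pow 2)).symm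
  have hr1' : 1 + r ≠ 0 := fun h => hne1 (-1) (by ring) (by linear_combination h)
  -- no square root of `-3` in `𝔽_ℓ`
  have hm3 : ∀ y : ZMod ℓ, y ^ 2 ≠ -3 := fun y hy => by
    have := three_dvd_sub_one_of_sq_eq_neg_three h2 hℓ3 y hy
    omega
  -- the two roots
  have hroot : ∀ k : ZMod ℓ, (2 * k + 9) ^ 2 = 45 → k ^ 2 + 9 * k + 9 = 0 := fun k hk =>
    eq_zero_of_const_mul_eq_zero h4 (by linear_combination hk)
  set k₁ : ZMod ℓ := (3 * r - 9) / 2 with hk₁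
  set k₂ : ZMod ℓ := (-3 * r - 9) / 2 with hk₂
  have e₁ : 2 * k₁ + 9 = 3 * r := by rw [hk₁]; field_simp; ring
  have e₂ : 2 * k₂ + 9 = -3 * r := by rw [hk₂]; field_simp; ring
  have hk1 : k₁ ^ 2 + 9 * k₁ + 9 = 0 := hroot k₁ (by rw [e₁]; linear_combination (-9 : ZMod ℓ) * hr)
  have hk2 : k₂ ^ 2 + 9 * k₂ + 9 = 0 := hroot k₂ (by rw [e₂]; linear_combination (-9 : ZMod ℓ) * hr)
  refine mk_prime_mul_ne_splitDiscriminantClassCM_of_two_roots hR (by norm_num) (by norm_num) disc_not_sq_nine_nine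
    ℓ hℓ k₁ k₂ (by push_cast; exact hk1) (by push_cast; exact hk2) ?_ ?_ ?_ w hw u hu
  · intro h
    have h' : 2 * k₁ + 9 = 2 * k₂ + 9 := by rw [h]
    rw [e₁, e₂] at h'
    have hr0 : r = 0 := eq_zero_of_const_mul_eq_zero (mul_ne_zero h2' h3') (by linear_combination h')
    rw [hr0, mul_zero] at hr
    exact h5' hr
  · intro x hx
    exact hr1 (eq_zero_of_sq_eq_mul_sq hm3 (2 * x) (1 - r)
      (by linear_combination (4 : ZMod ℓ) * hx + 2 * e₁ - 3 * hr))
  · intro x hx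
    exact hr1' (eq_zero_of_sq_eq_mul_sq hm3 (2 * x) (1 + r)
      (by linear_combination (4 : ZMod ℓ) * hx + 2 * e₂ - 3 * hr))

/-- **`[ℓ] ≠ [1]` for `E = ℚ(√-3,√5)` and every prime `ℓ ≡ ±1 (mod 5)`, `ℓ ≡ 2 (mod 3)`** (`ℓ ≡ 11, 14 (mod 15)`).
[cite: Deligne1982HodgeCycles, §4 p. 30 (1) and Cor. 4.2] -/
theorem sqrtNeg3Sqrt5_mk_prime_ne_splitDiscriminantClassCM_of_mod (ℓ : ℕ) (hℓ : ℓ.Prime)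
    (h5 : ℓ % 5 = 1 ∨ ℓ % 5 = 4) (h3 : ℓ % 3 = 2) (u : (realField R)ˣ) (hu : (u : realField R) = ℓ) :
    (QuotientGroup.mk u : cmNormResidueGroup R) ≠ splitDiscriminantClassCM R 2 :=
  sqrtNeg3Sqrt5_mk_prime_mul_ne_splitDiscriminantClassCM_of_mod hR ℓ hℓ h5 h3 1 (by exact_mod_cast hℓ.not_dvd_one) u
    (by rw [hu, Int.cast_one, mul_one]; exact (map_natCast (AdjoinRoot.of (realPolyQ R)) ℓ).symm)

end SqrtNeg3Sqrt5

/-! ### §3 `E = ℚ(i,√5)`: `R = S² + 3S + 1`, `F = ℚ(√5)`, `σ = -φ²` — every prime `ℓ ≡ ±1 (mod 5)`, `ℓ ≡ 3 (mod 4)`;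
`[ℓ] = [1]` for `ℓ ≢ 3 (mod 4)` -/

section SqrtNeg1Sqrt5

variable {R : Polynomial ℤ} (hR : R = X ^ 2 + C 3 * X + C 1) [Fact (Irreducible (realPolyQ R))]
include hR

/-- **`[ℓw] ≠ [1]` for `E = ℚ(i,√5)` and EVERY prime `ℓ ≡ ±1 (mod 5)`, `ℓ ≡ 3 (mod 4)`, `ℓ ∤ w`**: `ℓ` SPLITS in
`F = ℚ(√5)` (places `σ ↦ (-3 ± r)/2`, `2(-3 ∓ r)·2 = -(1 ± r)²`) and both places are INERT in `E = F(i)` (`-1` a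
non-square mod `ℓ`): the components `W8.E.[ℓw]` are NON-SPLIT (census rows `[11], [19], [31], [59], …` at once; ALL
the primes with `T(ℓ) ≠ ∅` for this field). [cite: Deligne1982HodgeCycles, §4 p. 30 (1) and Cor. 4.2]
[cite: Landherr1936HermitianForms] -/
theorem sqrtNeg1Sqrt5_mk_prime_mul_ne_splitDiscriminantClassCM_of_mod (ℓ : ℕ) (hℓ : ℓ.Prime)
    (h5 : ℓ % 5 = 1 ∨ ℓ % 5 = 4) (h4 : ℓ % 4 = 3) (w : ℤ) (hw : ¬ (ℓ : ℤ) ∣ w) (u : (realField R)ˣ)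
    (hu : (u : realField R) = AdjoinRoot.of (realPolyQ R) (ℓ * w)) :
    (QuotientGroup.mk u : cmNormResidueGroup R) ≠ splitDiscriminantClassCM R 2 := by
  haveI : Fact ℓ.Prime := ⟨hℓ⟩
  have h2 : ℓ ≠ 2 := by omega
  have hℓ5 : ℓ ≠ 5 := by omega
  have h2' : (2 : ZMod ℓ) ≠ 0 := by exact_mod_cast natCast_prime_ne_zero_zmod Nat.prime_two h2
  have h5' : (5 : ZMod ℓ) ≠ 0 := by exact_mod_cast natCast_prime_ne_zero_zmod (by norm_num : Nat.Prime 5) hℓ5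
  have h4' : (4 : ZMod ℓ) ≠ 0 := by rw [show (4 : ZMod ℓ) = 2 * 2 by norm_num]; exact mul_ne_zero h2' h2'
  have hm1 : ∀ y : ZMod ℓ, y ^ 2 ≠ -1 :=
    forall_sq_ne_of_not_isSquare (by rw [ZMod.exists_sq_eq_neg_one_iff]; omega)
  obtain ⟨r, hr⟩ := isSquare_five_of_mod_five h2 h5
  have hne1 : ∀ t : ZMod ℓ, t ^ 2 = 1 → r ≠ t := by
    rintro t ht rfl; rw [← sq, ht] at hr; exact h4' (by linear_combination hr)
  have hr1 : 1 - r ≠ 0 := sub_ne_zero.2 (hne1 1 (one_pow 2)).symm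
  have hr1' : 1 + r ≠ 0 := fun h => hne1 (-1) (by ring) (by linear_combination h)
  have hroot : ∀ k : ZMod ℓ, (2 * k + 3) ^ 2 = 5 → k ^ 2 + 3 * k + 1 = 0 := fun k hk =>
    eq_zero_of_const_mul_eq_zero h4' (by linear_combination hk)
  set k₁ : ZMod ℓ := (r - 3) / 2 with hk₁
  set k₂ : ZMod ℓ := (-r - 3) / 2 with hk₂
  have e₁ : 2 * k₁ + 3 = r := by rw [hk₁]; field_simp; ring
  have e₂ : 2 * k₂ + 3 = -r := by rw [hk₂]; field_simp; ring
  have hk1 : k₁ ^ 2 + 3 * k₁ + 1 = 0 := hroot k₁ (by rw [e₁]; linear_combination -hr)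
  have hk2 : k₂ ^ 2 + 3 * k₂ + 1 = 0 := hroot k₂ (by rw [e₂]; linear_combination -hr)
  refine mk_prime_mul_ne_splitDiscriminantClassCM_of_two_roots hR (by norm_num) (by norm_num) disc_not_sq_three_one
    ℓ hℓ k₁ k₂ (by push_cast; exact hk1) (by push_cast; exact hk2) ?_ ?_ ?_ w hw u hu
  · intro h
    have h' : 2 * k₁ + 3 = 2 * k₂ + 3 := by rw [h]
    rw [e₁, e₂] at h'
    have hr0 : r = 0 := eq_zero_of_const_mul_eq_zero h2' (by linear_combination h')
    rw [hr0, mul_zero] at hr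
    exact h5' hr
  · intro x hx
    exact hr1 (eq_zero_of_sq_eq_mul_sq hm1 (2 * x) (1 - r)
      (by linear_combination (4 : ZMod ℓ) * hx + 2 * e₁ - hr))
  · intro x hx
    exact hr1' (eq_zero_of_sq_eq_mul_sq hm1 (2 * x) (1 + r)
      (by linear_combination (4 : ZMod ℓ) * hx + 2 * e₂ - hr))

/-- **`[ℓ] ≠ [1]` for `E = ℚ(i,√5)` and every prime `ℓ ≡ 11, 19 (mod 20)`.**
[cite: Deligne1982HodgeCycles, §4 p. 30 (1) and Cor. 4.2] -/
theorem sqrtNeg1Sqrt5_mk_prime_ne_splitDiscriminantClassCM_of_mod (ℓ : ℕ) (hℓ : ℓ.Prime)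
    (h5 : ℓ % 5 = 1 ∨ ℓ % 5 = 4) (h4 : ℓ % 4 = 3) (u : (realField R)ˣ) (hu : (u : realField R) = ℓ) :
    (QuotientGroup.mk u : cmNormResidueGroup R) ≠ splitDiscriminantClassCM R 2 :=
  sqrtNeg1Sqrt5_mk_prime_mul_ne_splitDiscriminantClassCM_of_mod hR ℓ hℓ h5 h4 1 (by exact_mod_cast hℓ.not_dvd_one) u
    (by rw [hu, Int.cast_one, mul_one]; exact (map_natCast (AdjoinRoot.of (realPolyQ R)) ℓ).symm)

end SqrtNeg1Sqrt5

/-- **`[ℓ] = [1]` for `E = ℚ(i,√5)` and EVERY prime `ℓ ≢ 3 (mod 4)`** (`ℓ = a² + b² = Nm_{E/F}(a + bi)`, `i = -(2+σ)η`: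
the witness `a² - σ(2b + bσ)²` has coordinates `(ℓ, 0)`): the row `W8.E.[ℓ]` is the SPLIT component (census:
`2, 5, 13, 17, 29, 37, …`; `ℓ ≡ 3 (mod 4)`, `ℓ ≡ ±2 (mod 5)`: `[3] = [7] = [23] = [1]`, gen 49, by `2u² + 2uv + 3v²`).
Stated with Deligne's `R = S² + 3S + 1` LITERAL. [cite: Deligne1982HodgeCycles, §4 p. 30 (1) and Cor. 4.2] -/
theorem sqrtNeg1Sqrt5_mk_prime_eq_splitDiscriminantClassCM_of_mod_four (ℓ : ℕ) (hℓ : ℓ.Prime) (h4 : ℓ % 4 ≠ 3) :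
    haveI := fact_irreducible_realPolyQ_of_not_sq (R := X ^ 2 + C 3 * X + C 1) rfl disc_not_sq_three_one
    ∀ u : (realField (X ^ 2 + C 3 * X + C 1))ˣ, (u : realField (X ^ 2 + C 3 * X + C 1)) = ℓ →
      (QuotientGroup.mk u : cmNormResidueGroup (X ^ 2 + C 3 * X + C 1)) =
        splitDiscriminantClassCM (X ^ 2 + C 3 * X + C 1) 2 := by
  haveI := fact_irreducible_realPolyQ_of_not_sq (R := X ^ 2 + C 3 * X + C 1) rfl disc_not_sq_three_one
  haveI : Fact ℓ.Prime := ⟨hℓ⟩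
  intro u hu
  obtain ⟨a, b, hab⟩ := Nat.Prime.sq_add_sq h4
  have habZ : ((a : ℤ)) ^ 2 + (b : ℤ) ^ 2 = ℓ := by exact_mod_cast hab
  exact mk_eq_splitDiscriminantClassCM_two_of_coords_of_pos rfl (by norm_num) (by norm_num) disc_not_sq_three_one
    ℓ a 0 (2 * b) b 1 one_ne_zero (by linear_combination habZ) (by ring) u
    (by rw [hu]; push_cast; exact (map_natCast (AdjoinRoot.of (realPolyQ (X ^ 2 + C 3 * X + C 1))) ℓ).symm)


end Summit.HodgeConjecture.HodgeConjecture.Ring2.WeilCoverageCM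

end
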